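import Summits.QuantumFields.YangMills.Theorems.AlphaInputsT3ACv3OfDataSchema
import Literature.MathematicalPhysics.QuantumFieldTheory.Balaban1983to89.T3SmallLiftHistory
import HarnessLib

/-!
# `AlphaInputsT3ACv3WindowIneq` — STRATEGY B for 2′: THE WINDOW INEQUALITY (N1) DISCHARGED from ONE inequality on the record's `C68` (design note
# `STRATEGY-B-adapted-class-T3-alpha1-g5.md` §B.4 (N1)) — lane `pub-balaban3d`, seat alpha-2 (g0)

WHAT.  The displayed constants row (N1) `AlphaInputsT3AC.WindowIneqT3 F 𝔠 γ K` («`2L²·avgWindowFactor(L)·θBal(K+1) ≤ C68·θBal(K)`») of `DataSchemaT3AC`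
holds for EVERY coupling `0 < γ ≤ 1` and every `K` as soon as `2L²·avgWindowFactor(L)·L^{−1/2}·(1 + ½log L)^{p₀} ≤ C68`: one step down the threshold
`θ(i) = g_i p(g_i)` grows by at most the factor `L^{−1/2}(1 + ½ log L)^{p₀}` (`g_{i+1} = L^{−1/2}g_i` and `1 + log g_{i+1}⁻¹ = (1 + log g_i⁻¹) + ½log L ≤
(1 + log g_i⁻¹)(1 + ½log L)`) — `θBal_succ_le_ratio_mul`, uniform in `γ ∈ (0, 1]`.  §3: the schema ∕ the v3 package from the two DATA clauses alone
((D6) non-emptiness; «(D5) ∧ data rows»), (N1) discharged (`dataSchemaT3AC_of_parts`, `ofV3At_of_parts`).  THEOREMS ONLY.  Count-neutral; nothing about the mass gap.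

References: T. Bałaban, Commun. Math. Phys. 102 (1985) 255–275 [Balaban1985UV3] ((3) p.256, (7) p.257, (40) p.266, (68) p.273).
-/

set_option autoImplicit false

noncomputable section

namespace Summit.QuantumFields.YangMills.Theorems

open Literature.MathematicalPhysics.QuantumFieldTheory.Balaban1983to89
open Literature.MathematicalPhysics.QuantumFieldTheory.Balaban1983to89.T3ContinuumYM3Torus
open Literature.MathematicalPhysics.QuantumFieldTheory.Balaban1983to89.T3UnitScaleTilt (θBal)
open Literature.MathematicalPhysics.QuantumFieldTheory.Balaban1983to89.T3Thresholds (θBal_eq coupling_le_one)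
open Literature.MathematicalPhysics.QuantumFieldTheory.Balaban1983to89.T3ThresholdSmallness (sqrt_coupling_pos_le)
open Literature.MathematicalPhysics.QuantumFieldTheory.Balaban1985CMP102.Setting
open Summit.QuantumFields.Balaban3D.Carriers
open Summit.QuantumFields.Balaban3D.Proofs.Primitives

/-! ## §1 The threshold ratio from above -/

/-- `p(g/√L) ≤ (1 + ½log L)^{p₀}·p(g)` for `0 < g ≤ 1`, `L ≥ 1`, `b₀, p₀ ≥ 0`: `1 + log(√L/g) = (1 + log g⁻¹) + ½log L ≤ (1 + log g⁻¹)(1 + ½log L)`.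
[cite: Balaban1985UV3, (7) p.257] -/
theorem AlphaInputsT3AC.pFun_sqrt_inv_mul_le {L : ℕ} (hL : 1 ≤ L) {b₀ p₀ g : ℝ} (hb : 0 ≤ b₀) (hp : 0 ≤ p₀) (hg : 0 < g) (hg1 : g ≤ 1) :
    B10.pFun b₀ p₀ (Real.sqrt ((L : ℝ)⁻¹) * g) ≤ (1 + Real.log (L : ℝ) / 2) ^ p₀ * B10.pFun b₀ p₀ g := by
  have hL' : (1 : ℝ) ≤ L := by exact_mod_cast hL
  have hL0 : (0 : ℝ) < L := by linarith
  have hs : 0 < Real.sqrt ((L : ℝ)⁻¹) := Real.sqrt_pos.2 (inv_pos.mpr hL0)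
  have hlogL : 0 ≤ Real.log (L : ℝ) := Real.log_nonneg hL'
  have hlogg : 0 ≤ Real.log g⁻¹ := Real.log_nonneg ((one_le_inv₀ hg).mpr hg1)
  have hinv : (Real.sqrt ((L : ℝ)⁻¹) * g)⁻¹ = Real.sqrt (L : ℝ) * g⁻¹ := by
    rw [mul_inv, Real.sqrt_inv, inv_inv]
  have hlog : Real.log (Real.sqrt ((L : ℝ)⁻¹) * g)⁻¹ = Real.log (L : ℝ) / 2 + Real.log g⁻¹ := by
    rw [hinv, Real.log_mul (Real.sqrt_pos.2 hL0).ne' (inv_pos.mpr hg).ne', Real.log_sqrt hL0.le]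
  unfold B10.pFun
  rw [hlog]
  have ha : 1 ≤ 1 + Real.log g⁻¹ := by linarith
  have hkey : 1 + (Real.log (L : ℝ) / 2 + Real.log g⁻¹) ≤ (1 + Real.log (L : ℝ) / 2) * (1 + Real.log g⁻¹) := by
    nlinarith [mul_nonneg hlogL hlogg]
  have h0 : 0 ≤ 1 + (Real.log (L : ℝ) / 2 + Real.log g⁻¹) := by linarith
  calc b₀ * (1 + (Real.log (L : ℝ) / 2 + Real.log g⁻¹)) ^ p₀
      ≤ b₀ * ((1 + Real.log (L : ℝ) / 2) * (1 + Real.log g⁻¹)) ^ p₀ :=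
        mul_le_mul_of_nonneg_left (Real.rpow_le_rpow h0 hkey hp) hb
    _ = (1 + Real.log (L : ℝ) / 2) ^ p₀ * (b₀ * (1 + Real.log g⁻¹) ^ p₀) := by
        rw [Real.mul_rpow (by linarith) (by linarith)]; ring

/-- **ONE STEP DOWN COSTS AT MOST `L^{−1/2}(1 + ½log L)^{p₀}`**: `θBal(i+1) ≤ √(L⁻¹)·(1 + ½log L)^{p₀}·θBal(i)` for `0 < γ ≤ 1`, `L ≥ 1`, `b₀, p₀ ≥ 0` — the
upper twin of `T3SmallLiftHistory.sqrt_inv_mul_θBal_le_succ`, UNIFORM in the coupling. [cite: Balaban1985UV3, (3) p.256 and (7) p.257] -/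
theorem AlphaInputsT3AC.θBal_succ_le_ratio_mul {L : ℕ} (hL : 1 ≤ L) {γ b₀ p₀ : ℝ} (hγ : 0 < γ) (hγ1 : γ ≤ 1) (hb : 0 ≤ b₀) (hp : 0 ≤ p₀) (i : ℕ) :
    θBal L γ b₀ p₀ (i + 1) ≤ Real.sqrt ((L : ℝ)⁻¹) * (1 + Real.log (L : ℝ) / 2) ^ p₀ * θBal L γ b₀ p₀ i := by
  rw [θBal_eq, θBal_eq]
  have hLinv : 0 ≤ ((L : ℝ)⁻¹) := inv_nonneg.mpr (Nat.cast_nonneg L)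
  have hgi := (sqrt_coupling_pos_le hL hγ i).1
  have hgi1 : Real.sqrt (γ * ((L : ℝ)⁻¹) ^ i) ≤ 1 := coupling_le_one hL hγ hγ1 i
  have hsucc : Real.sqrt (γ * ((L : ℝ)⁻¹) ^ (i + 1)) = Real.sqrt ((L : ℝ)⁻¹) * Real.sqrt (γ * ((L : ℝ)⁻¹) ^ i) := by
    rw [← Real.sqrt_mul hLinv]
    congr 1
    ring
  rw [hsucc]
  have hp_le := AlphaInputsT3AC.pFun_sqrt_inv_mul_le hL hb hp hgi hgi1 (p₀ := p₀)
  have hs0 : 0 ≤ Real.sqrt ((L : ℝ)⁻¹) * Real.sqrt (γ * ((L : ℝ)⁻¹) ^ i) := mul_nonneg (Real.sqrt_nonneg _) hgi.le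
  calc Real.sqrt ((L : ℝ)⁻¹) * Real.sqrt (γ * ((L : ℝ)⁻¹) ^ i) * B10.pFun b₀ p₀ (Real.sqrt ((L : ℝ)⁻¹) * Real.sqrt (γ * ((L : ℝ)⁻¹) ^ i))
      ≤ Real.sqrt ((L : ℝ)⁻¹) * Real.sqrt (γ * ((L : ℝ)⁻¹) ^ i) * ((1 + Real.log (L : ℝ) / 2) ^ p₀ * B10.pFun b₀ p₀ (Real.sqrt (γ * ((L : ℝ)⁻¹) ^ i))) :=
        mul_le_mul_of_nonneg_left hp_le hs0
    _ = Real.sqrt ((L : ℝ)⁻¹) * (1 + Real.log (L : ℝ) / 2) ^ p₀ * (Real.sqrt (γ * ((L : ℝ)⁻¹) ^ i) * B10.pFun b₀ p₀ (Real.sqrt (γ * ((L : ℝ)⁻¹) ^ i))) := by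
        ring

/-! ## §2 (N1) from one inequality on `C68` -/

/-- **(N1) DISCHARGED FROM `2L²·avgWindowFactor(L)·L^{−1/2}(1 + ½log L)^{p₀} ≤ C68`**: for every coupling `0 < γ ≤ 1` and every `K`, the window inequality
`AlphaInputsT3AC.WindowIneqT3 F 𝔠 γ K` of the displayed schema holds. [cite: Balaban1985UV3, (40) p.266 + (68) p.273] -/
theorem AlphaInputsT3AC.windowIneqT3_of_le {F : T3Family} {𝔠 : AlphaConsts F.L (suGroupModel 2).N}
    (hC : 2 * (F.L : ℝ) ^ 2 * avgWindowFactor F.L * (Real.sqrt ((F.L : ℝ)⁻¹) * (1 + Real.log (F.L : ℝ) / 2) ^ 𝔠.p₀) ≤ 𝔠.C68)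
    {γ : ℝ} (hγ : 0 < γ) (hγ1 : γ ≤ 1) (K : ℕ) : AlphaInputsT3AC.WindowIneqT3 F 𝔠 γ K := by
  have hL : 1 ≤ F.L := F.hL.2.le
  have hθ := AlphaInputsT3AC.θBal_succ_le_ratio_mul hL hγ hγ1 𝔠.b₀_pos.le 𝔠.p₀_pos.le K
  have hθ0 : 0 ≤ θBal F.L γ 𝔠.b₀ 𝔠.p₀ K := by
    rw [θBal_eq]
    exact mul_nonneg (Real.sqrt_nonneg _)
      (B10.pFun_nonneg 𝔠.b₀ 𝔠.p₀ _ 𝔠.b₀_pos.le (sqrt_coupling_pos_le hL hγ K).1 (coupling_le_one hL hγ hγ1 K))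
  have hw0 : 0 ≤ 2 * (F.L : ℝ) ^ 2 * avgWindowFactor F.L := by unfold avgWindowFactor; positivity
  unfold AlphaInputsT3AC.WindowIneqT3
  calc 2 * (F.L : ℝ) ^ 2 * avgWindowFactor F.L * θBal F.L γ 𝔠.b₀ 𝔠.p₀ (K + 1)
      ≤ 2 * (F.L : ℝ) ^ 2 * avgWindowFactor F.L * (Real.sqrt ((F.L : ℝ)⁻¹) * (1 + Real.log (F.L : ℝ) / 2) ^ 𝔠.p₀ * θBal F.L γ 𝔠.b₀ 𝔠.p₀ K) :=
        mul_le_mul_of_nonneg_left hθ hw0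
    _ = 2 * (F.L : ℝ) ^ 2 * avgWindowFactor F.L * (Real.sqrt ((F.L : ℝ)⁻¹) * (1 + Real.log (F.L : ℝ) / 2) ^ 𝔠.p₀) * θBal F.L γ 𝔠.b₀ 𝔠.p₀ K := by
        ring
    _ ≤ 𝔠.C68 * θBal F.L γ 𝔠.b₀ 𝔠.p₀ K := mul_le_mul_of_nonneg_right hC hθ0

/-- **(N1) ON THE PACKAGE'S COUPLING WINDOW**: under the same inequality, `WindowIneqT3 F 𝔠 γ K` for every `γ ∈ (0, (min γ₀ 1)²]` and every `K` — the row
as `DataSchemaT3AC` quantifies it. [cite: Balaban1985UV3, (40) p.266 + (68) p.273] -/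
theorem AlphaInputsT3AC.windowIneqT3_of_le_window {F : T3Family} {𝔠 : AlphaConsts F.L (suGroupModel 2).N}
    (hC : 2 * (F.L : ℝ) ^ 2 * avgWindowFactor F.L * (Real.sqrt ((F.L : ℝ)⁻¹) * (1 + Real.log (F.L : ℝ) / 2) ^ 𝔠.p₀) ≤ 𝔠.C68)
    {γ : ℝ} (hγ : 0 < γ) (hγ1 : γ ≤ (min 𝔠.gamma0 1) ^ 2) (K : ℕ) : AlphaInputsT3AC.WindowIneqT3 F 𝔠 γ K :=
  AlphaInputsT3AC.windowIneqT3_of_le hC hγ (hγ1.trans (sq_min_one_le _ 𝔠.gamma0_pos)) K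

/-- **THE SCHEMA FROM ITS DATA PARTS, (N1) DISCHARGED**: under the `C68`-inequality, `DataSchemaT3AC F 𝔠 a₀ a₁` follows from the two DATA clauses alone —
(D6) non-emptiness of the adapted classes and the ∃-clause «trivial-history minimiser rows ∧ cluster-expansion data rows» — at every coupling of the package's
window and every run. [cite: Balaban1985UV3, Thm 2 p.272 + (40) p.266 + (68) p.273] -/
theorem AlphaInputsT3AC.dataSchemaT3AC_of_parts {F : T3Family} {𝔠 : AlphaConsts F.L (suGroupModel 2).N} {a₀ a₁ : ℝ}
    (hC : 2 * (F.L : ℝ) ^ 2 * avgWindowFactor F.L * (Real.sqrt ((F.L : ℝ)⁻¹) * (1 + Real.log (F.L : ℝ) / 2) ^ 𝔠.p₀) ≤ 𝔠.C68)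
    (hne : ∀ (γ : ℝ) (hγ : 0 < γ) (hγ1 : γ ≤ (min 𝔠.gamma0 1) ^ 2) (K : ℕ), AlphaInputsT3AC.AdaptedClassNonemptyT3 F 𝔠 γ hγ hγ1 K)
    (hdata : ∀ (γ : ℝ) (hγ : 0 < γ) (hγ1 : γ ≤ (min 𝔠.gamma0 1) ^ 2) (K : ℕ),
      ∃ Ut : (k : ℕ) → GaugeField (F.P K) k (Matrix.specialUnitaryGroup (Fin 2) ℂ) → GaugeField (F.P K) 0 (Matrix.specialUnitaryGroup (Fin 2) ℂ),
        AlphaInputsT3AC.TrivMinimiserRowsT3 F 𝔠 γ hγ hγ1 a₀ a₁ K Ut ∧ AlphaInputsT3AC.DataRowsT3 F 𝔠 γ hγ hγ1 K Ut) :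
    DataSchemaT3AC F 𝔠 a₀ a₁ :=
  fun γ hγ hγ1 K => ⟨AlphaInputsT3AC.windowIneqT3_of_le_window hC hγ hγ1 K, hne γ hγ hγ1 K, hdata γ hγ hγ1 K⟩

/-- **`OfV3At` FROM THE DATA PARTS, (N1) DISCHARGED** (`ofV3At_of_dataSchemaT3 ∘ dataSchemaT3AC_of_parts`). [cite: Balaban1985UV3, Thm 2 p.272] -/
theorem AlphaInputsT3AC.ofV3At_of_parts {F : T3Family} {𝔠 : AlphaConsts F.L (suGroupModel 2).N} {a₀ a₁ : ℝ}
    (hC : 2 * (F.L : ℝ) ^ 2 * avgWindowFactor F.L * (Real.sqrt ((F.L : ℝ)⁻¹) * (1 + Real.log (F.L : ℝ) / 2) ^ 𝔠.p₀) ≤ 𝔠.C68)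
    (hne : ∀ (γ : ℝ) (hγ : 0 < γ) (hγ1 : γ ≤ (min 𝔠.gamma0 1) ^ 2) (K : ℕ), AlphaInputsT3AC.AdaptedClassNonemptyT3 F 𝔠 γ hγ hγ1 K)
    (hdata : ∀ (γ : ℝ) (hγ : 0 < γ) (hγ1 : γ ≤ (min 𝔠.gamma0 1) ^ 2) (K : ℕ),
      ∃ Ut : (k : ℕ) → GaugeField (F.P K) k (Matrix.specialUnitaryGroup (Fin 2) ℂ) → GaugeField (F.P K) 0 (Matrix.specialUnitaryGroup (Fin 2) ℂ),
        AlphaInputsT3AC.TrivMinimiserRowsT3 F 𝔠 γ hγ hγ1 a₀ a₁ K Ut ∧ AlphaInputsT3AC.DataRowsT3 F 𝔠 γ hγ hγ1 K Ut) :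
    AlphaInputsT3AC.OfV3At F 𝔠 a₀ a₁ :=
  AlphaInputsT3AC.ofV3At_of_dataSchemaT3 (AlphaInputsT3AC.dataSchemaT3AC_of_parts hC hne hdata)

end Summit.QuantumFields.YangMills.Theorems

end
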